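import Literature.RingTheory.FormalGroups.NilpotentEvaluationPair
import Mathlib.RingTheory.Polynomial.Quotient
import Mathlib.RingTheory.TensorProduct.Maps
import HarnessLib

/-!
# The functor of points of the truncated polynomial algebra `A[X]⧸(X^N)` is `R ↦ {r ∈ R ∣ r^N = 0}`
# ([Tate 1967] §2.2; [Bourbaki, Algebra II] Ch. IV §1 no. 3 — P6d points currency (β), part 6)

Topic `Literature/RingTheory/FormalGroups`; namespace `Literature.RingTheory.FormalGroups.TruncatedPolynomial`.  Three plumbing
DEFINITIONS (`liftOfPowEqZero`, `algHomEquiv`, `tensorAlgHomEquiv`) and theorems; no named fact, no instance, no notation, no `sorry`.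
Cell `hodgecm-mathlib`, P6 «MOD programme» ROW 4B: the RING-LEVEL Yoneda bridge between the layer algebras
`Polynomial k ⧸ Ideal.span {X ^ (p ^ (n H))}` of a connected one-dimensional `p`-divisible group (the P6d letter `IsConnectedDimOne`)
and the NILPOTENT-POINTS currency (`TorsPts`, ★ `evalNilp`, ★ `evalNilp₂`):

* `A`-algebra maps `A[X]⧸(X^N) → R` are the same as elements `r ∈ R` with `r ^ N = 0` (`algHomEquiv`, `φ ↦ φ(x̄)`), naturally in `R`
  and compatibly with the truncations `A[X]⧸(X^{N′}) ↠ A[X]⧸(X^N)`, `N ≤ N′` (the `incl` clause);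
* under this identification a map `φ` sends the class of the truncation of a power series `f ∈ A⟦X⟧` to `evalNilp f r`
  (`apply_mk_trunc`) — the `[pⁿ]`∕`[a]` clauses;
* `A`-algebra maps out of the TENSOR SQUARE `A[X]⧸(X^N) ⊗_A A[X]⧸(X^M)` are pairs `(r, s)` with `r^N = 0 = s^M` (`tensorAlgHomEquiv`),
  and such a map sends the class of the double truncation of `F ∈ A⟦X,Y⟧` to `evalNilp₂ F r s` (`apply_sum_tmul`) — the `μ` clause once
  `Γ(G ×_k G) ≅ Γ(G) ⊗_k Γ(G)`.
-/

noncomputable section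

namespace Literature.RingTheory.FormalGroups.TruncatedPolynomial

open Polynomial TensorProduct

universe u v w

variable {A : Type u} [CommRing A] {N M : ℕ} {R : Type v} [CommRing R] [Algebra A R] {R' : Type w} [CommRing R'] [Algebra A R']

/-! ## §1 The universal nilpotent point `x̄ = X mod X^N` -/

variable (A N) in
/-- `x̄ ^ N = 0` in `A[X]⧸(X^N)`. [cite: BourbakiAlgebraII2003, Ch. IV §1 no. 3] -/
theorem mk_X_pow_eq_zero : (Ideal.Quotient.mk (Ideal.span {(X : A[X]) ^ N}) X) ^ N = 0 := by
  rw [← map_pow, Ideal.Quotient.eq_zero_iff_mem]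
  exact Ideal.subset_span rfl

variable (A N) in
/-- `x̄` is nilpotent. [cite: BourbakiAlgebraII2003, Ch. IV §1 no. 3] -/
theorem isNilpotent_mk_X : IsNilpotent (Ideal.Quotient.mk (Ideal.span {(X : A[X]) ^ N}) X) := ⟨N, mk_X_pow_eq_zero A N⟩

/-- Every element of `A[X]⧸(X^N)` is the class of a polynomial: `mk` is `aeval x̄`. [cite: BourbakiAlgebraII2003, Ch. IV §1 no. 3] -/
theorem aeval_mk_X (g : A[X]) :
    aeval (Ideal.Quotient.mk (Ideal.span {(X : A[X]) ^ N}) X) g = Ideal.Quotient.mk (Ideal.span {(X : A[X]) ^ N}) g := by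
  rw [← Ideal.Quotient.mkₐ_eq_mk A, aeval_algHom_apply, aeval_X_left_apply]

/-- **An `A`-algebra map out of `A[X]⧸(X^N)` is evaluation at the image of `x̄`**: `φ (ḡ) = g(φ x̄)`.
[cite: BourbakiAlgebraII2003, Ch. IV §1 no. 3] -/
theorem apply_mk (φ : (A[X] ⧸ Ideal.span {(X : A[X]) ^ N}) →ₐ[A] R) (g : A[X]) :
    φ (Ideal.Quotient.mk (Ideal.span {(X : A[X]) ^ N}) g) = aeval (φ (Ideal.Quotient.mk (Ideal.span {(X : A[X]) ^ N}) X)) g := by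
  rw [aeval_algHom_apply, aeval_mk_X]

/-- The image of `x̄` satisfies `r ^ N = 0`. [cite: BourbakiAlgebraII2003, Ch. IV §1 no. 3] -/
theorem apply_mk_X_pow (φ : (A[X] ⧸ Ideal.span {(X : A[X]) ^ N}) →ₐ[A] R) :
    φ (Ideal.Quotient.mk (Ideal.span {(X : A[X]) ^ N}) X) ^ N = 0 := by
  rw [← map_pow, mk_X_pow_eq_zero, map_zero]

/-- **Two `A`-algebra maps out of `A[X]⧸(X^N)` agreeing on `x̄` are equal.** [cite: BourbakiAlgebraII2003, Ch. IV §1 no. 3] -/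
theorem algHom_ext {φ ψ : (A[X] ⧸ Ideal.span {(X : A[X]) ^ N}) →ₐ[A] R}
    (h : φ (Ideal.Quotient.mk (Ideal.span {(X : A[X]) ^ N}) X) = ψ (Ideal.Quotient.mk (Ideal.span {(X : A[X]) ^ N}) X)) : φ = ψ := by
  refine Ideal.Quotient.algHom_ext A (Polynomial.algHom_ext ?_)
  simpa only [AlgHom.comp_apply, Ideal.Quotient.mkₐ_eq_mk] using h

/-! ## §2 Lifting a nilpotent element to an algebra map -/

variable (A N) in
/-- **The `A`-algebra map `A[X]⧸(X^N) → R`, `x̄ ↦ r`, for `r ^ N = 0`.** [cite: BourbakiAlgebraII2003, Ch. IV §1 no. 3] -/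
def liftOfPowEqZero (r : R) (hr : r ^ N = 0) : (A[X] ⧸ Ideal.span {(X : A[X]) ^ N}) →ₐ[A] R :=
  Ideal.Quotient.liftₐ _ (aeval r) fun a ha => by
    obtain ⟨q, rfl⟩ := Ideal.mem_span_singleton.mp ha
    rw [map_mul, map_pow, aeval_X, hr, zero_mul]

/-- `liftOfPowEqZero r` on classes of polynomials is `aeval r`. [cite: BourbakiAlgebraII2003, Ch. IV §1 no. 3] -/
@[simp] theorem liftOfPowEqZero_mk (r : R) (hr : r ^ N = 0) (g : A[X]) :
    liftOfPowEqZero A N r hr (Ideal.Quotient.mk (Ideal.span {(X : A[X]) ^ N}) g) = aeval r g := rfl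

/-- `liftOfPowEqZero r x̄ = r`. [cite: BourbakiAlgebraII2003, Ch. IV §1 no. 3] -/
@[simp] theorem liftOfPowEqZero_mk_X (r : R) (hr : r ^ N = 0) :
    liftOfPowEqZero A N r hr (Ideal.Quotient.mk (Ideal.span {(X : A[X]) ^ N}) X) = r := by
  rw [liftOfPowEqZero_mk, aeval_X]

/-! ## §3 The points of `A[X]⧸(X^N)` -/

variable (A N R) in
/-- **THE FUNCTOR OF POINTS OF `A[X]⧸(X^N)`: `Hom_A(A[X]⧸(X^N), R) ≃ {r ∈ R ∣ r ^ N = 0}`, `φ ↦ φ(x̄)`.**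
[cite: Tate1967, §2.2] [cite: BourbakiAlgebraII2003, Ch. IV §1 no. 3] -/
def algHomEquiv : ((A[X] ⧸ Ideal.span {(X : A[X]) ^ N}) →ₐ[A] R) ≃ {r : R // r ^ N = 0} where
  toFun φ := ⟨φ (Ideal.Quotient.mk (Ideal.span {(X : A[X]) ^ N}) X), apply_mk_X_pow φ⟩
  invFun r := liftOfPowEqZero A N r.1 r.2
  left_inv _ := algHom_ext (liftOfPowEqZero_mk_X _ _)
  right_inv _ := Subtype.ext (liftOfPowEqZero_mk_X _ _)

/-- `algHomEquiv φ = φ(x̄)`. [cite: Tate1967, §2.2] -/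
@[simp] theorem algHomEquiv_apply (φ : (A[X] ⧸ Ideal.span {(X : A[X]) ^ N}) →ₐ[A] R) :
    (algHomEquiv A N R φ).1 = φ (Ideal.Quotient.mk (Ideal.span {(X : A[X]) ^ N}) X) := rfl

/-- `algHomEquiv.symm r = liftOfPowEqZero r`. [cite: Tate1967, §2.2] -/
theorem algHomEquiv_symm_apply (r : {r : R // r ^ N = 0}) : (algHomEquiv A N R).symm r = liftOfPowEqZero A N r.1 r.2 := rfl

/-- `(algHomEquiv.symm r) ḡ = g(r)`. [cite: Tate1967, §2.2] -/
@[simp] theorem algHomEquiv_symm_apply_mk (r : {r : R // r ^ N = 0}) (g : A[X]) :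
    (algHomEquiv A N R).symm r (Ideal.Quotient.mk (Ideal.span {(X : A[X]) ^ N}) g) = aeval r.1 g := rfl

/-- `(algHomEquiv.symm r) x̄ = r`. [cite: Tate1967, §2.2] -/
@[simp] theorem algHomEquiv_symm_apply_mk_X (r : {r : R // r ^ N = 0}) :
    (algHomEquiv A N R).symm r (Ideal.Quotient.mk (Ideal.span {(X : A[X]) ^ N}) X) = r.1 :=
  liftOfPowEqZero_mk_X r.1 r.2

/-! ## §4 Naturality in `R` and in the level `N` -/

/-- **Naturality in `R`**: post-composition with `ψ : R → R'` is `r ↦ ψ r`. [cite: Tate1967, §2.2] -/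
theorem algHomEquiv_comp (ψ : R →ₐ[A] R') (φ : (A[X] ⧸ Ideal.span {(X : A[X]) ^ N}) →ₐ[A] R) :
    (algHomEquiv A N R' (ψ.comp φ)).1 = ψ (algHomEquiv A N R φ).1 := rfl

/-- The same, on the inverse: `ψ ∘ (x̄ ↦ r) = (x̄ ↦ ψ r)`. [cite: Tate1967, §2.2] -/
theorem comp_algHomEquiv_symm (ψ : R →ₐ[A] R') (r : {r : R // r ^ N = 0}) :
    ψ.comp ((algHomEquiv A N R).symm r) =
      (algHomEquiv A N R').symm ⟨ψ r.1, by rw [← map_pow, r.2, map_zero]⟩ :=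
  algHom_ext (by simp only [AlgHom.comp_apply, algHomEquiv_symm_apply_mk_X])

/-- `(X^{N'}) ≤ (X^N)` for `N ≤ N'`: the truncation `A[X]⧸(X^{N'}) ↠ A[X]⧸(X^N)` exists. [cite: BourbakiAlgebraII2003, Ch. IV §1 no. 3] -/
theorem span_X_pow_le (h : N ≤ M) : Ideal.span {(X : A[X]) ^ M} ≤ Ideal.span {(X : A[X]) ^ N} :=
  Ideal.span_singleton_le_span_singleton.mpr (pow_dvd_pow X h)

/-- **Naturality in the level**: pre-composition with the truncation `A[X]⧸(X^{N'}) ↠ A[X]⧸(X^N)` (`N ≤ N'`) does not move the point —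
the inclusion `{r ∣ r^N = 0} ⊆ {r ∣ r^{N'} = 0}` (the `incl` of the `p`-divisible group in coordinates). [cite: Tate1967, §2.2] -/
theorem algHomEquiv_comp_factor (h : N ≤ M) (φ : (A[X] ⧸ Ideal.span {(X : A[X]) ^ N}) →ₐ[A] R) :
    (algHomEquiv A M R (φ.comp (Ideal.Quotient.factorₐ A (span_X_pow_le h)))).1 = (algHomEquiv A N R φ).1 := rfl

/-- The same, on the inverse: `(x̄ ↦ r) ∘ trunc = (x̄ ↦ r)` at level `N' ≥ N`. [cite: Tate1967, §2.2] -/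
theorem algHomEquiv_symm_comp_factor (h : N ≤ M) (r : {r : R // r ^ N = 0}) :
    ((algHomEquiv A N R).symm r).comp (Ideal.Quotient.factorₐ A (span_X_pow_le h)) =
      (algHomEquiv A M R).symm ⟨r.1, pow_eq_zero_of_le h r.2⟩ :=
  algHom_ext (by simp only [AlgHom.comp_apply, Ideal.Quotient.factorₐ_apply_mk, algHomEquiv_symm_apply_mk_X])

/-! ## §5 Evaluation link: power series through their truncations -/

/-- **`φ` sends the class of the truncation `f mod X^N` of a power series `f` to `evalNilp f (φ x̄)`.**
[cite: Tate1967, §2.2] [cite: BourbakiAlgebraII2003, Ch. IV §4 no. 3] -/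
theorem apply_mk_trunc (φ : (A[X] ⧸ Ideal.span {(X : A[X]) ^ N}) →ₐ[A] R) (f : PowerSeries A) :
    φ (Ideal.Quotient.mk (Ideal.span {(X : A[X]) ^ N}) (PowerSeries.trunc N f)) =
      evalNilp f (φ (Ideal.Quotient.mk (Ideal.span {(X : A[X]) ^ N}) X)) := by
  rw [apply_mk, evalNilp_eq_aeval_trunc f (apply_mk_X_pow φ)]

/-- The same for the inverse: `(x̄ ↦ r) (f mod X^N) = evalNilp f r`. [cite: Tate1967, §2.2] -/
theorem algHomEquiv_symm_apply_mk_trunc (r : {r : R // r ^ N = 0}) (f : PowerSeries A) :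
    (algHomEquiv A N R).symm r (Ideal.Quotient.mk (Ideal.span {(X : A[X]) ^ N}) (PowerSeries.trunc N f)) = evalNilp f r.1 := by
  rw [apply_mk_trunc, algHomEquiv_symm_apply_mk_X]

/-- The class of `f mod X^N` only depends on `f` through `evalNilp f x̄`: it IS `evalNilp f x̄`. [cite: BourbakiAlgebraII2003, Ch. IV §4 no. 3] -/
theorem mk_trunc_eq_evalNilp (f : PowerSeries A) :
    Ideal.Quotient.mk (Ideal.span {(X : A[X]) ^ N}) (PowerSeries.trunc N f) =
      evalNilp f (Ideal.Quotient.mk (Ideal.span {(X : A[X]) ^ N}) X) := by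
  rw [← aeval_mk_X, evalNilp_eq_aeval_trunc f (mk_X_pow_eq_zero A N)]

/-! ## §6 The tensor square: pairs of nilpotent points -/

variable (A N M R) in
/-- **Points of `A[X]⧸(X^N) ⊗_A A[X]⧸(X^M)` are pairs `(r, s)` with `r^N = 0 = s^M`** (`φ ↦ (φ(x̄ ⊗ 1), φ(1 ⊗ x̄))`).
[cite: Tate1967, §2.2] [cite: BourbakiAlgebraII2003, Ch. IV §1 no. 3] -/
def tensorAlgHomEquiv :
    ((A[X] ⧸ Ideal.span {(X : A[X]) ^ N}) ⊗[A] (A[X] ⧸ Ideal.span {(X : A[X]) ^ M}) →ₐ[A] R) ≃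
      {rs : R × R // rs.1 ^ N = 0 ∧ rs.2 ^ M = 0} where
  toFun φ := ⟨((algHomEquiv A N R (φ.comp Algebra.TensorProduct.includeLeft)).1,
      (algHomEquiv A M R (φ.comp Algebra.TensorProduct.includeRight)).1),
    (algHomEquiv A N R _).2, (algHomEquiv A M R _).2⟩
  invFun rs := Algebra.TensorProduct.lift ((algHomEquiv A N R).symm ⟨rs.1.1, rs.2.1⟩) ((algHomEquiv A M R).symm ⟨rs.1.2, rs.2.2⟩)
    fun _ _ => Commute.all _ _
  left_inv φ := by
    refine Algebra.TensorProduct.ext' fun a b => ?_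
    rw [Algebra.TensorProduct.lift_tmul]
    have ha : (algHomEquiv A N R).symm ⟨_, (algHomEquiv A N R (φ.comp Algebra.TensorProduct.includeLeft)).2⟩ =
        φ.comp Algebra.TensorProduct.includeLeft := (algHomEquiv A N R).symm_apply_apply _
    have hb : (algHomEquiv A M R).symm ⟨_, (algHomEquiv A M R (φ.comp Algebra.TensorProduct.includeRight)).2⟩ =
        φ.comp Algebra.TensorProduct.includeRight := (algHomEquiv A M R).symm_apply_apply _
    rw [ha, hb, AlgHom.comp_apply, AlgHom.comp_apply, Algebra.TensorProduct.includeLeft_apply,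
      Algebra.TensorProduct.includeRight_apply, ← map_mul, Algebra.TensorProduct.tmul_mul_tmul, mul_one, one_mul]
  right_inv rs := by
    ext
    · simp only [AlgHom.comp_apply, Algebra.TensorProduct.includeLeft_apply, algHomEquiv_apply, Algebra.TensorProduct.lift_tmul,
        map_one, mul_one, algHomEquiv_symm_apply_mk_X]
    · simp only [AlgHom.comp_apply, Algebra.TensorProduct.includeRight_apply, algHomEquiv_apply, Algebra.TensorProduct.lift_tmul,
        map_one, one_mul, algHomEquiv_symm_apply_mk_X]

/-- `tensorAlgHomEquiv φ = (φ(x̄ ⊗ 1), φ(1 ⊗ x̄))`. [cite: Tate1967, §2.2] -/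
theorem tensorAlgHomEquiv_apply (φ : (A[X] ⧸ Ideal.span {(X : A[X]) ^ N}) ⊗[A] (A[X] ⧸ Ideal.span {(X : A[X]) ^ M}) →ₐ[A] R) :
    (tensorAlgHomEquiv A N M R φ).1 =
      (φ (Ideal.Quotient.mk (Ideal.span {(X : A[X]) ^ N}) X ⊗ₜ 1), φ (1 ⊗ₜ Ideal.Quotient.mk (Ideal.span {(X : A[X]) ^ M}) X)) := rfl

/-- `(tensorAlgHomEquiv.symm (r, s)) (ḡ ⊗ h̄) = g(r) h(s)`. [cite: Tate1967, §2.2] -/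
@[simp] theorem tensorAlgHomEquiv_symm_apply_tmul (rs : {rs : R × R // rs.1 ^ N = 0 ∧ rs.2 ^ M = 0}) (g h : A[X]) :
    (tensorAlgHomEquiv A N M R).symm rs
        (Ideal.Quotient.mk (Ideal.span {(X : A[X]) ^ N}) g ⊗ₜ Ideal.Quotient.mk (Ideal.span {(X : A[X]) ^ M}) h) =
      aeval rs.1.1 g * aeval rs.1.2 h :=
  Algebra.TensorProduct.lift_tmul _ _ (fun _ _ => Commute.all _ _) _ _

/-- **Naturality in `R`** of `tensorAlgHomEquiv`. [cite: Tate1967, §2.2] -/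
theorem tensorAlgHomEquiv_comp (ψ : R →ₐ[A] R')
    (φ : (A[X] ⧸ Ideal.span {(X : A[X]) ^ N}) ⊗[A] (A[X] ⧸ Ideal.span {(X : A[X]) ^ M}) →ₐ[A] R) :
    (tensorAlgHomEquiv A N M R' (ψ.comp φ)).1 = Prod.map ψ ψ (tensorAlgHomEquiv A N M R φ).1 := rfl

/-- **A map `φ` out of the tensor square sends the class of the DOUBLE TRUNCATION `Σ_{i<N, j<M} F_{ij} x̄^i ⊗ x̄^j` of a two-variable
series `F` to `evalNilp₂ F r s`**, `(r, s) = (φ(x̄ ⊗ 1), φ(1 ⊗ x̄))` — the co-multiplication clause `μ ↦ F`-addition in coordinates.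
[cite: Tate1967, §2.2] [cite: BourbakiAlgebraII2003, Ch. IV §4 no. 3] -/
theorem apply_sum_tmul (φ : (A[X] ⧸ Ideal.span {(X : A[X]) ^ N}) ⊗[A] (A[X] ⧸ Ideal.span {(X : A[X]) ^ M}) →ₐ[A] R)
    (F : MvPowerSeries (Fin 2) A) :
    φ (∑ i ∈ Finset.range N, ∑ j ∈ Finset.range M, MvPowerSeries.coeff (Finsupp.single 0 i + Finsupp.single 1 j) F •
        ((Ideal.Quotient.mk (Ideal.span {(X : A[X]) ^ N}) X ^ i) ⊗ₜ[A] (Ideal.Quotient.mk (Ideal.span {(X : A[X]) ^ M}) X ^ j))) =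
      evalNilp₂ F (φ (Ideal.Quotient.mk (Ideal.span {(X : A[X]) ^ N}) X ⊗ₜ 1))
        (φ (1 ⊗ₜ Ideal.Quotient.mk (Ideal.span {(X : A[X]) ^ M}) X)) := by
  -- `map_pow` for `φ` through its underlying ring map (the generic `MonoidHomClass` instance is not found on this tensor type)
  have hpow : ∀ (t : (A[X] ⧸ Ideal.span {(X : A[X]) ^ N}) ⊗[A] (A[X] ⧸ Ideal.span {(X : A[X]) ^ M})) (n : ℕ),
      φ (t ^ n) = φ t ^ n := fun t n => φ.toRingHom.map_pow t n
  have hr : φ (Ideal.Quotient.mk (Ideal.span {(X : A[X]) ^ N}) X ⊗ₜ 1) ^ N = 0 := by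
    rw [← hpow, Algebra.TensorProduct.tmul_pow, one_pow, mk_X_pow_eq_zero, zero_tmul, map_zero]
  have hs : φ (1 ⊗ₜ Ideal.Quotient.mk (Ideal.span {(X : A[X]) ^ M}) X) ^ M = 0 := by
    rw [← hpow, Algebra.TensorProduct.tmul_pow, one_pow, mk_X_pow_eq_zero, tmul_zero, map_zero]
  rw [evalNilp₂_eq_sum F hr hs, map_sum]
  refine Finset.sum_congr rfl fun i _ => ?_
  rw [map_sum]
  refine Finset.sum_congr rfl fun j _ => ?_
  rw [map_smul, Algebra.smul_def, mul_assoc, ← hpow, ← hpow, ← map_mul, Algebra.TensorProduct.tmul_pow,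
    Algebra.TensorProduct.tmul_pow, one_pow, one_pow, Algebra.TensorProduct.tmul_mul_tmul, mul_one, one_mul]

/-- The same for the inverse: `(tensorAlgHomEquiv.symm (r,s)) (Σ F_{ij} x̄^i ⊗ x̄^j) = evalNilp₂ F r s`. [cite: Tate1967, §2.2] -/
theorem tensorAlgHomEquiv_symm_apply_sum_tmul (rs : {rs : R × R // rs.1 ^ N = 0 ∧ rs.2 ^ M = 0}) (F : MvPowerSeries (Fin 2) A) :
    (tensorAlgHomEquiv A N M R).symm rs
        (∑ i ∈ Finset.range N, ∑ j ∈ Finset.range M, MvPowerSeries.coeff (Finsupp.single 0 i + Finsupp.single 1 j) F •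
          ((Ideal.Quotient.mk (Ideal.span {(X : A[X]) ^ N}) X ^ i) ⊗ₜ[A] (Ideal.Quotient.mk (Ideal.span {(X : A[X]) ^ M}) X ^ j))) =
      evalNilp₂ F rs.1.1 rs.1.2 := by
  have h := congrArg Subtype.val ((tensorAlgHomEquiv A N M R).apply_symm_apply rs)
  rw [tensorAlgHomEquiv_apply] at h
  have h1 := congrArg Prod.fst h
  have h2 := congrArg Prod.snd h
  dsimp only at h1 h2
  rw [apply_sum_tmul, h1, h2]

end Literature.RingTheory.FormalGroups.TruncatedPolynomial
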